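import Summits.BirchSwinnertonDyer.BirchSwinnertonDyer.Theorems.ByReductionTypeAtTwoAdditiveCubicResolventDescent
import HarnessLib

/-!
# Route `ByReductionTypeAtTwo` (rung K4), crux `AdditiveRankZeroAtTwo` (item
# stmt-BirchSwinnertonDyer-19098): the CUBIC-RESOLVENT DESCENT, part 4 — Door D: the `p`-part over
# `ℚ` is INVARIANT under the resolvent twist granted the two `p`-parts over the cubic field

HONEST FRAMING (cell `bsd-2adic`, run/shared/lean/pub/bsd-2adic/, HUMAN RULINGS D-0036/D-0074;
seat `bsd-2adic-addL2x` GEN 3): theorems only; NO new definition, NO new named fact; the PRINT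
inputs are consumed BY NAME (`hmod`, `hMilneC`, `hDD`, `hArtin`, `hBC3`, `hBC6`, and `hGZK` in the
closed form); nothing asserted; no class closed; nothing booked; BSD is not proved by any of this.
PARTITION (D-0054): X5@2 ADDITIVE, defect-`≥ 3` sub-class (odd core `C₃` reading) × p = 2 —
types-the-object-of; closes none. bears_on: K4 (item 19098).

From part 3's defect identity (★★) `δ_p(E/ℚ) − δ_p(E^{(d_K)}/ℚ) = δ_p(E_F) − δ_p(E^{(d_K)}_F)`:
* `shaAnOverC_base_ne_zero`, `exists_shaAn_twist_eq_of_descent` — rationality ASCENDS to the twist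
  (the MAIN IDENTITY of part 2 is symmetric);
* Door D `missingPPartAt_iff_twist_of_overF` — `MissingPPartOverCAt VF p ∧ MissingPPartOverCAt VF' p
  ⟹ (MissingPPartAt W p ↔ MissingPPartAt Wd p)`;
* closed form `bsdp_iff_bsdp_twist_of_overCubicResolvent` — `BSD(E,p) ⟺ BSD(E^{(d_K)},p)` granted the
  two `p`-parts over ONE cubic field `F` with `d_F = d_K f²` (`L` discharged by the tree's
  `exists_resolventClosure`, `Ш/ℚ` by Gross–Zagier–Kolyvagin).
READING (p = 2, odd core): the «field of good reduction» input (BSD₂ for `E_F`, `E^{(D)}_F`, good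
supersingular at `𝔓`, `𝔓³ = 2`) makes BSD₂ CONSTANT along the inert-twist pairs of record; with one
member decided (GEN 2's census: 1 381 / 1 382) the class follows (part 3, Door A).

References: [DokchitserDokchitserAnnals2010] Thm. 2.3, §2.4.
-/

set_option autoImplicit false
-- the Theorems namespace of this sub repeats the summit name by design (D-0017 nested layout)
set_option linter.dupNamespace false

noncomputable section

open scoped Classical

open WeierstrassCurve Literature.NumberTheory.EllipticCurves
  Literature.NumberTheory.EllipticCurves.Rank1Residual
  Literature.NumberTheory.EllipticCurves.Rank1Residual.Typed
  Summit.BirchSwinnertonDyer.Rank1Residual.AdditivePotMult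

namespace Summit.BirchSwinnertonDyer.BirchSwinnertonDyer.Theorems.CubicResolvent

/-! ## Door D: twist-invariance of the `p`-part granted the two `p`-parts over `F` -/

section DoorD

variable {W : WeierstrassCurve ℚ} [W.IsElliptic] [W.IsGloballyMinimal]
  {Wd : WeierstrassCurve ℚ} [Wd.IsElliptic] [Wd.IsGloballyMinimal] (p : ℕ) [Fact p.Prime]
  {K : Type} [Field K] [NumberField K] {F : Type} [Field F] [NumberField F]
  {L : Type} [Field L] [NumberField L] [Algebra F L] [Algebra K L]
  {VF : WeierstrassCurve F} [VF.IsElliptic] {VF' : WeierstrassCurve F} [VF'.IsElliptic]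
  (hmod : hasEntireLFunction_rat)
  (hMilneC : Milne1972.bsdQuotient_baseChange_quadratic_anyModel)
  (hDD : DokchitserDokchitser2010.bsdQuotient_brauerS3_anyModel) (hArtin : LSeries_brauerS3)
  (hBC3 : hasEntireLFunction_baseChange_cubic)
  (hBC6 : hasEntireLFunction_baseChange_of_isGalois_six)
  (hK2 : Module.finrank ℚ K = 2) (hF3 : Module.finrank ℚ F = 3) {f : ℤ} (hf : f ≠ 0)
  (hdisc : NumberField.discr F = NumberField.discr K * f ^ 2)
  (hL6 : Module.finrank ℚ L = 6) (hGal : IsGalois ℚ L)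
  (hWd : ∃ C : VariableChange ℚ, C • W.quadraticTwist (NumberField.discr K : ℚ) = Wd)
  (hVF : ∃ C : VariableChange F, C • W.baseChange F = VF)
  (hVF' : ∃ C : VariableChange F, C • Wd.baseChange F = VF')
  (hshaW : W.ShaFinite) (hshaWd : Wd.ShaFinite) (hshaF : VF.ShaFinite) (hshaF' : VF'.ShaFinite)

include hBC3 hF3 hVF hshaF in
omit [Fact p.Prime] [W.IsGloballyMinimal] [Wd.IsGloballyMinimal] [Wd.IsElliptic] [NumberField K]
  [Field K] [Algebra F L] [Algebra K L] [NumberField L] [Field L] [VF'.IsElliptic] in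
/-- `#Ш_an(VF) ≠ 0` likewise. [folklore] -/
theorem shaAnOverC_base_ne_zero : shaAnOverC VF ≠ 0 := by
  obtain ⟨C, hC⟩ := hVF
  have hent : VF.HasEntireLFunction := by
    rw [← hC, hasEntireLFunction_smul_iff]; exact hBC3 W F hF3
  have hℓ : VF.leadingLCoeff ≠ 0 := VF.leadingLCoeff_ne_zero_holds hent
  have hn : (VF.shaOrder : ℂ) ≠ 0 := by exact_mod_cast (VF.shaOrder_pos hshaF).ne'
  intro h0
  have := shaAnOverC_mul_quotient (M := F) VF
  rw [h0, zero_mul] at this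
  exact mul_ne_zero hℓ hn this.symm

include hmod hMilneC hDD hArtin hBC3 hBC6 hK2 hF3 hf hdisc hL6 hGal hWd hVF hVF' hshaW hshaWd hshaF
  hshaF'

omit [Fact p.Prime] in
/-- Rationality ASCENDS to the twist as well: `#Ш_an(W)`, `#Ш_an(VF)`, `#Ш_an(VF')` rational ⟹
`#Ш_an(Wd)` rational (the MAIN IDENTITY is symmetric). [folklore] -/
theorem exists_shaAn_twist_eq_of_descent {q qF qF' : ℚ}
    (hq : shaAn W = (q : ℂ)) (hqF : shaAnOverC VF = (qF : ℂ))
    (hqF' : shaAnOverC VF' = (qF' : ℂ)) : ∃ qd : ℚ, shaAn Wd = (qd : ℂ) := by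
  have hid := sha_sq_identity W Wd K F L VF VF' hmod hMilneC hDD hArtin hBC3 hBC6 hK2
    hF3 hf hdisc hL6 hGal hWd hVF hVF' hshaW hshaWd hshaF hshaF'
  have hqF0 : (qF : ℂ) ≠ 0 := by
    rw [← hqF]; exact shaAnOverC_base_ne_zero hBC3 hF3 hVF hshaF
  have hnW : (W.shaOrder : ℂ) ≠ 0 := by exact_mod_cast (W.shaOrder_pos hshaW).ne'
  have hnF' : (VF'.shaOrder : ℂ) ≠ 0 := by exact_mod_cast (VF'.shaOrder_pos hshaF').ne'
  set r : ℚ := q * qF' * Wd.shaOrder * VF.shaOrder / (qF * W.shaOrder * VF'.shaOrder) with hr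
  have hsq : shaAn Wd ^ 2 = (r : ℂ) ^ 2 := by
    have hden : ((qF : ℂ) * (W.shaOrder : ℂ) * (VF'.shaOrder : ℂ)) ≠ 0 :=
      mul_ne_zero (mul_ne_zero hqF0 hnW) hnF'
    rw [hr]
    push_cast
    rw [div_pow, eq_div_iff (pow_ne_zero _ hden), ← mul_pow]
    rw [hq, hqF, hqF'] at hid
    linear_combination -hid
  rcases sq_eq_sq_iff_eq_or_eq_neg.mp hsq with h | h
  · exact ⟨r, h⟩
  · exact ⟨-r, by rw [h, Rat.cast_neg]⟩

/-- **Door D (any `p`): the two `p`-parts over `F` make the `p`-part over `ℚ` INVARIANT under the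
resolvent twist** — `MissingPPartAt W p ↔ MissingPPartAt Wd p`: with `δ_p(VF) = δ_p(VF') = 0`,
(★★) reads `δ_p(E/ℚ) = δ_p(E^{(d_K)}/ℚ)`. [folklore] -/
theorem missingPPartAt_iff_twist_of_overF
    (hF : MissingPPartOverCAt VF p) (hF' : MissingPPartOverCAt VF' p) :
    MissingPPartAt W p ↔ MissingPPartAt Wd p := by
  obtain ⟨qF, hqF, hvF⟩ := hF
  obtain ⟨qF', hqF', hvF'⟩ := hF'
  constructor
  · rintro ⟨q, hq, hv⟩
    obtain ⟨qd, hqd⟩ := exists_shaAn_twist_eq_of_descent hmod hMilneC hDD hArtin hBC3 hBC6 hK2 hF3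
      hf hdisc hL6 hGal hWd hVF hVF' hshaW hshaWd hshaF hshaF' hq hqF hqF'
    refine ⟨qd, hqd, ?_⟩
    have h := defect_eq_of_descent p hmod hMilneC hDD hArtin hBC3 hBC6 hK2 hF3 hf hdisc hL6 hGal hWd
      hVF hVF' hshaW hshaWd hshaF hshaF' hq hqd hqF hqF'
    linarith
  · rintro ⟨qd, hqd, hvd⟩
    obtain ⟨q, hq, -⟩ := exists_shaAn_eq_of_descent p hmod hMilneC hDD hArtin hBC3 hBC6 hK2 hF3 hf
      hdisc hL6 hGal hWd hVF hVF' hshaW hshaWd hshaF hshaF' hqd hqF hqF'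
    refine ⟨q, hq, ?_⟩
    have h := defect_eq_of_descent p hmod hMilneC hDD hArtin hBC3 hBC6 hK2 hF3 hf hdisc hL6 hGal hWd
      hVF hVF' hshaW hshaWd hshaF hshaF' hq hqd hqF hqF'
    linarith

end DoorD

/-! ## Door D, closed form -/

section DoorDClosed

open Literature.NumberTheory.CubicFields

variable {W : WeierstrassCurve ℚ} [W.IsElliptic] [W.IsGloballyMinimal]
  {Wd : WeierstrassCurve ℚ} [Wd.IsElliptic] [Wd.IsGloballyMinimal] (p : ℕ) [Fact p.Prime]
  {K : Type} [Field K] [NumberField K] {F : Type} [Field F] [NumberField F]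
  {VF : WeierstrassCurve F} [VF.IsElliptic] {VF' : WeierstrassCurve F} [VF'.IsElliptic]

/-- **Door D, closed form (any `p`): granted the `p`-parts of BSD for `E` and `E^{(d_K)}` over ONE
cubic field `F` with `d_F = d_K f²`, `BSD(E,p) ⟺ BSD(E^{(d_K)},p)`** (`W`, `Wd` globally minimal of
analytic rank `≤ 1`; the sextic closure and `Ш/ℚ` discharged as in part 3). For the crux at `p = 2`:
on the odd core the «field of good reduction» input makes BSD₂ constant along the inert-twist
orbits of record. [folklore] -/
theorem bsdp_iff_bsdp_twist_of_overCubicResolvent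
    (hGZK : rank_eq_analyticRank_of_analyticRank_le_one) (hmod : hasEntireLFunction_rat)
    (hMilneC : Milne1972.bsdQuotient_baseChange_quadratic_anyModel)
    (hDD : DokchitserDokchitser2010.bsdQuotient_brauerS3_anyModel) (hArtin : LSeries_brauerS3)
    (hBC3 : hasEntireLFunction_baseChange_cubic)
    (hBC6 : hasEntireLFunction_baseChange_of_isGalois_six)
    (hK2 : Module.finrank ℚ K = 2) (hF3 : Module.finrank ℚ F = 3) {f : ℤ} (hf : f ≠ 0)
    (hdisc : NumberField.discr F = NumberField.discr K * f ^ 2)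
    (hWd : ∃ C : VariableChange ℚ, C • W.quadraticTwist (NumberField.discr K : ℚ) = Wd)
    (hVF : ∃ C : VariableChange F, C • W.baseChange F = VF)
    (hVF' : ∃ C : VariableChange F, C • Wd.baseChange F = VF')
    (hr : W.analyticRank ≤ 1) (hrd : Wd.analyticRank ≤ 1)
    (hshaF : VF.ShaFinite) (hshaF' : VF'.ShaFinite)
    (hF : MissingPPartOverCAt VF p) (hF' : MissingPPartOverCAt VF' p) :
    BSDp W p ↔ BSDp Wd p := by
  obtain ⟨L, hfd, h3, hab, hgal, h6, ⟨ι⟩, -⟩ := exists_resolventClosure hK2 F hF3 hf hdisc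
  haveI := hfd
  haveI : FiniteDimensional ℚ L := Module.Finite.trans K L
  haveI : CharZero L := charZero_of_injective_algebraMap (algebraMap K L).injective
  haveI : NumberField L := NumberField.mk
  letI : Algebra F L := ι.toRingHom.toAlgebra
  have hshaW : W.ShaFinite := (hGZK W hr).2
  have hshaWd : Wd.ShaFinite := (hGZK Wd hrd).2
  haveI : Finite Wd.sha := hshaWd
  haveI : Finite W.sha := hshaW
  rw [show BSDp W p ↔ MissingPPartAt W p from
      ⟨fun h => missingPPartAt_of_bsdp W p h, fun h => bsdp_of_missingPPartAt W p hGZK hr h⟩,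
    show BSDp Wd p ↔ MissingPPartAt Wd p from
      ⟨fun h => missingPPartAt_of_bsdp Wd p h, fun h => bsdp_of_missingPPartAt Wd p hGZK hrd h⟩]
  exact missingPPartAt_iff_twist_of_overF (L := L) p hmod hMilneC hDD hArtin hBC3 hBC6 hK2 hF3 hf
    hdisc h6 hgal hWd hVF hVF' hshaW hshaWd hshaF hshaF' hF hF'

end DoorDClosed

end Summit.BirchSwinnertonDyer.BirchSwinnertonDyer.Theorems.CubicResolvent

end
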